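import Summits.QuantumFields.YangMills.Theorems.ToronSmallBallOwnAxisShiftTranslate
import Summits.QuantumFields.YangMills.Theorems.ToronSmallBallOwnAxisShiftTwist
import Summits.QuantumFields.YangMills.Theorems.ToronSmallBallOwnAxisShiftDomination
import Summits.QuantumFields.YangMills.Theorems.QuantileBitPuritySectorGoodReduction
import Literature.MathematicalPhysics.QuantumFieldTheory.Balaban1983to89.T4HaarSU2Translate
import HarnessLib

/-!
# The own-axis sheet shift: one shift dominates a generic off-core strip by a disjoint image (every sector without `x`-twist)

Support module (`--supports` stmt-QuantumFields-24092, `QuantileBitPurity.HolonomyLevyWindowDeepR`; seat ym-dw-p1 g15).  GENERIC VERSION of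
`ToronSmallBallOwnAxisShiftDomination` (which served ⟨24089⟩): the seam sector is any `z` with `z 0 = false` (module `…OwnAxisShiftTwist`) and the strip is
`{|polDist U₀ − f(U₀)| ≤ w, c₀ < polDist U₀}` for any measurable slice functional `f` invariant under the own-axis shift (`f = polDist ∘ S` gives the
swap strip of ⟨24089⟩, `f = c` constant the Lévy window of ⟨24092⟩).  On the ring of `n+1` slices consider, inside the good-field event `goodEvent n 0 s t`, the OFF-CORE STRIP of the slice-`0` holonomies
`A = {|polDist U₀ − f(U₀)| ≤ w, c₀ < polDist U₀}` split by the hemisphere of the `x`-holonomy through the origin (`re q(P) ≥ 0`, resp. `≤ 0`).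
For a shift angle `θ` with `|θ| ≤ σ/2`, where `σ ≤ c₀/2 − 2L²√s − nLt` is the non-centrality floor, the own-axis shift of every slice maps the lower
half `A₊` (with `0 ≤ θ ≤ π/2`) into the explicit event
`B₊(θ) = {0 ≤ r − θ ≤ π/2, |√(4−4|cos(r−θ)|) − f(U₀)| ≤ w, c₀ < √(4−4|cos(r−θ)|)}`, `r = arccos(re q(polyX U₀))`,
and the upper half `A₋` (with `−π/2 ≤ θ ≤ 0`) into the mirror event `B₋(θ)`; and

★ `sectorWeight_stripLowerGen_le` / `sectorWeight_stripUpperGen_le`: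
`W₀(𝟙_{A±}) ≤ exp(β(n+1)(#P·b_P + #E·b_T)) · ((1 − |θ|/σ)⁻²)^{#plane·(n+1)} · W₀(𝟙_{B±(θ)})`
(`b_P, b_T` the second-order costs of `ToronSmallBallOwnAxisShiftCost` with `ε = √s`, `τ = t`).  The events `B±(kθ')`, `k = 1, 2, …`, are pairwise
disjoint as soon as `θ' ≥ 5w` (`B_disjoint_lowerGen/upperGen`, strip separation of `ToronSmallBallOwnAxisShiftAngle`).

HONEST FRAMING: fixed-lattice inequalities; nothing about infinite volume, the continuum limit or the Clay gap.  No `sorry`, no new axiom, no new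
definition.  References: [cite: Luscher1983, §2]; [cite: MontvayMunster1994, (3.145)].
-/

set_option autoImplicit false

noncomputable section

open MeasureTheory Set Function
open scoped BigOperators
open Literature.MathematicalPhysics.QuantumLattice (su2Quat su2Quat_ne_zero norm_su2Quat)
open Literature.MathematicalPhysics.QuantumFieldTheory hiding su2Quat_mul
open Literature.MathematicalPhysics.QuantumFieldTheory.Balaban1983to89.T4HaarSU2ExpChart (expPoint)
open Literature.MathematicalPhysics.QuantumFieldTheory.Balaban1983to89.T4HaarSU2Translate (continuous_su2Quat)

namespace Summit.QuantumFields.YangMills.Theorems.FemtoTransferGap.OwnAxis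

open ClassShift FlatSheet
open Summit.QuantumFields.YangMills.Theorems.FemtoTransferGap.TT

variable {L : ℕ} [NeZero L]

/-! ## §1 Measurability of the generic strip -/

/-- The generic off-core strip `{|polDist U − f U| ≤ w, c₀ < polDist U}` is measurable. [folklore] -/
theorem measurableSet_stripGen {f : GaugeConfig 3 L SU2 → ℝ} (hfm : Measurable f) (w c₀ : ℝ) :
    MeasurableSet {U : GaugeConfig 3 L SU2 | |polDist U - f U| ≤ w ∧ c₀ < polDist U} := by
  have h1 : Measurable fun U : GaugeConfig 3 L SU2 => |polDist U - f U| := (measurable_polDist.sub hfm).abs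
  rw [Set.setOf_and]
  exact (measurableSet_le h1 measurable_const).inter (measurableSet_lt measurable_const measurable_polDist)

/-! ## §2 The lower hemisphere -/

/-- ★ **Lower-hemisphere domination.**  See the module docstring; `θ ∈ [0, π/2]`, `|θ| ≤ σ/2`, `0 < σ ≤ 1`, `σ ≤ c₀/2 − 2L²√s − nLt`, `β ≥ 0`.
[cite: Luscher1983, §2] [cite: MontvayMunster1994, (3.145)] -/
theorem sectorWeight_stripLowerGen_le {z : Fin 3 → Bool} (hz : z 0 = false) {f : GaugeConfig 3 L SU2 → ℝ} (hfm : Measurable f) {θ : ℝ}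
    (hfinv : ∀ U : GaugeConfig 3 L SU2, f (ownShift θ U) = f U) {β : ℝ} (hβ : 0 ≤ β) (n : ℕ) {s t w c₀ σ : ℝ} (hσ : 0 < σ) (hσ1 : σ ≤ 1)
    (hσle : σ ≤ c₀ / 2 - 2 * (L * (L * Real.sqrt s)) - n * (L * t)) (hθ0 : 0 ≤ θ) (hθσ : θ ≤ σ / 2) (hθπ : θ ≤ Real.pi / 2) :
    sectorWeight β n z (fun Us g =>
        {p : (Site 3 L → SU2) × (Fin (n + 1) → GaugeConfig 3 L SU2) |
          p ∈ goodEvent n z s t ∧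
          (|polDist (p.2 0) - f (p.2 0)| ≤ w ∧ c₀ < polDist (p.2 0)) ∧
          0 ≤ (su2Quat (polyX (p.2 0))).re}.indicator (fun _ => (1 : ℝ)) (g, Us)) ≤
      Real.exp (β * ((n + 1 : ℕ) * (Fintype.card (Plaquette 3 L) * ((|θ| * (2 * (L * Real.sqrt s) / σ)) ^ 2 + 2 * (|θ| * (2 * (L * Real.sqrt s) / σ)) * Real.sqrt s) +
          Fintype.card (Edge 3 L) * ((|θ| * (2 * (L * t) / σ)) ^ 2 + 2 * (|θ| * (2 * (L * t) / σ)) * t)))) *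
        ((((1 - |θ| / σ) ^ 2)⁻¹) ^ (Finset.univ.filter (fun x : Site 3 L => x 0 = 0)).card) ^ (n + 1) *
      sectorWeight β n z (fun Us g =>
        {p : (Site 3 L → SU2) × (Fin (n + 1) → GaugeConfig 3 L SU2) |
          (0 ≤ Real.arccos (su2Quat (polyX (p.2 0))).re - θ ∧ Real.arccos (su2Quat (polyX (p.2 0))).re - θ ≤ Real.pi / 2) ∧
          |Real.sqrt (4 - 4 * |Real.cos (Real.arccos (su2Quat (polyX (p.2 0))).re - θ)|) - f (p.2 0)| ≤ w ∧
          c₀ < Real.sqrt (4 - 4 * |Real.cos (Real.arccos (su2Quat (polyX (p.2 0))).re - θ)|)}.indicator (fun _ => (1 : ℝ)) (g, Us)) := by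
  have hθabs : |θ| = θ := abs_of_nonneg hθ0
  have hθ' : |θ| ≤ σ / 2 := by rw [hθabs]; exact hθσ
  -- shell parameters
  have ha : 0 < Real.arcsin σ := Real.arcsin_pos.2 hσ
  have hσa : σ ≤ Real.arcsin σ := le_arcsin_self hσ.le hσ1
  have hbπ : Real.pi - Real.arcsin σ < Real.pi := by linarith
  have haθ : 0 < Real.arcsin σ + θ := by linarith
  have hbθ : Real.pi - Real.arcsin σ + θ < Real.pi := by linarith
  have hρ : 0 ≤ ((1 - |θ| / σ) ^ 2)⁻¹ := by positivity
  have hsin : ∀ r : ℝ, Real.arcsin σ ≤ r → r ≤ Real.pi - Real.arcsin σ → Real.sin r ^ 2 ≤ ((1 - |θ| / σ) ^ 2)⁻¹ * Real.sin (r + θ) ^ 2 :=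
    fun r hr1 hr2 => sin_sq_le_rho_mul hσ hσ1 hθ' hr1 hr2
  -- measurability of the two events
  have hproj : Measurable fun p : (Site 3 L → SU2) × (Fin (n + 1) → GaugeConfig 3 L SU2) => p.2 0 := (measurable_pi_apply 0).comp measurable_snd
  have hA : MeasurableSet {p : (Site 3 L → SU2) × (Fin (n + 1) → GaugeConfig 3 L SU2) |
      p ∈ goodEvent n z s t ∧
      (|polDist (p.2 0) - f (p.2 0)| ≤ w ∧ c₀ < polDist (p.2 0)) ∧
      0 ≤ (su2Quat (polyX (p.2 0))).re} := by
    have h1 : MeasurableSet {p : (Site 3 L → SU2) × (Fin (n + 1) → GaugeConfig 3 L SU2) | p ∈ goodEvent n z s t} :=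
      measurableSet_goodEvent (L := L) n z s t
    have h2 : MeasurableSet {p : (Site 3 L → SU2) × (Fin (n + 1) → GaugeConfig 3 L SU2) |
        |polDist (p.2 0) - f (p.2 0)| ≤ w ∧ c₀ < polDist (p.2 0)} := hproj (measurableSet_stripGen (L := L) hfm w c₀)
    have h3 : MeasurableSet {p : (Site 3 L → SU2) × (Fin (n + 1) → GaugeConfig 3 L SU2) | 0 ≤ (su2Quat (polyX (p.2 0))).re} :=
      measurableSet_le measurable_const (measurable_re_su2Quat_polyX.comp hproj)
    rw [measurableSet_setOf] at h1 h2 h3 ⊢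
    exact h1.and (h2.and h3)
  have hr : Measurable fun p : (Site 3 L → SU2) × (Fin (n + 1) → GaugeConfig 3 L SU2) => Real.arccos (su2Quat (polyX (p.2 0))).re - θ :=
    (Real.continuous_arccos.measurable.comp (measurable_re_su2Quat_polyX.comp hproj)).sub measurable_const
  have hg : Measurable fun p : (Site 3 L → SU2) × (Fin (n + 1) → GaugeConfig 3 L SU2) =>
      Real.sqrt (4 - 4 * |Real.cos (Real.arccos (su2Quat (polyX (p.2 0))).re - θ)|) :=
    (measurable_const.sub ((Real.continuous_cos.measurable.comp hr).abs.const_mul _)).sqrt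
  have hpdS : Measurable fun p : (Site 3 L → SU2) × (Fin (n + 1) → GaugeConfig 3 L SU2) => f (p.2 0) := hfm.comp hproj
  have hB : MeasurableSet {p : (Site 3 L → SU2) × (Fin (n + 1) → GaugeConfig 3 L SU2) |
      (0 ≤ Real.arccos (su2Quat (polyX (p.2 0))).re - θ ∧ Real.arccos (su2Quat (polyX (p.2 0))).re - θ ≤ Real.pi / 2) ∧
      |Real.sqrt (4 - 4 * |Real.cos (Real.arccos (su2Quat (polyX (p.2 0))).re - θ)|) - f (p.2 0)| ≤ w ∧
      c₀ < Real.sqrt (4 - 4 * |Real.cos (Real.arccos (su2Quat (polyX (p.2 0))).re - θ)|)} := by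
    have h1 := measurableSet_le (measurable_const (a := (0 : ℝ))) hr
    have h2 := measurableSet_le hr (measurable_const (a := Real.pi / 2))
    have h3 := measurableSet_le ((hg.sub hpdS).abs) (measurable_const (a := w))
    have h4 := measurableSet_lt (measurable_const (a := c₀)) hg
    rw [measurableSet_setOf] at h1 h2 h3 h4 ⊢
    exact (h1.and h2).and (h3.and h4)
  -- the translate lemma with Jacobian
  refine sectorWeight_indicator_le_of_ownShift (L := L) β n z ha hbπ haθ hbθ hρ hsin hA hB ?_ ?_ (Real.exp_pos _).le ?_
  · -- (i) shell: every plane line of every slice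
    rintro p ⟨hgood, ⟨-, hcore⟩, -⟩ k x hx
    exact lineHolonomy_mem_shell_of_goodEvent_z z hσ hgood (by linarith) k hx
  · -- (ii) the image lands in `B₊(θ)`
    rintro p ⟨hgood, ⟨hstrip, hcore⟩, hre⟩
    have hfloor : σ ≤ ‖imVec (su2Quat (polyX (p.2 0)))‖ := by
      rw [polyX_eq_lineHolonomy]
      exact floor_of_goodEvent_z z hgood (by linarith) 0 0 (by simp)
    have hnc : imVec (su2Quat (polyX (p.2 0))) ≠ 0 := fun h => by rw [h, norm_zero] at hfloor; linarith
    set r := Real.arccos (su2Quat (polyX (p.2 0))).re with hrdef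
    have hr0 : 0 ≤ r := Real.arccos_nonneg _
    have hrπ2 : r ≤ Real.pi / 2 := Real.arccos_le_pi_div_two.2 hre
    simp only [Set.mem_setOf_eq]
    rw [polyX_ownShift, arccos_re_classShift hnc (by linarith) (by linarith [Real.pi_pos]), hfinv,
      show Real.arccos (su2Quat (polyX (p.2 0))).re + θ - θ = r by rw [hrdef]; ring, ← vacDist_eq_sqrt_angle]
    exact ⟨⟨hr0, hrπ2⟩, hstrip, hcore⟩
  · -- (iii) the cost
    rintro p ⟨hgood, ⟨-, hcore⟩, -⟩
    obtain ⟨hP, hTi, hTs⟩ := goodEvent_dictionary_z z hgood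
    have hNC : ∀ (k : Fin (n + 1)) (y : Site 3 L), y 0 = 0 → σ ≤ ‖imVec (su2Quat (lineHolonomy (p.2 k) 0 L y))‖ :=
      fun k y hy => floor_of_goodEvent_z z hgood (by linarith) k y hy
    exact seamDensity_le_exp_mul_ownShift_z hz hβ θ hσ p.2 p.1 hNC hP hTi hTs

/-! ## §3 The upper hemisphere -/

/-- ★ **Upper-hemisphere domination** (shift `θ ∈ [−π/2, 0]`, `|θ| ≤ σ/2`). [cite: Luscher1983, §2] [cite: MontvayMunster1994, (3.145)] -/
theorem sectorWeight_stripUpperGen_le {z : Fin 3 → Bool} (hz : z 0 = false) {f : GaugeConfig 3 L SU2 → ℝ} (hfm : Measurable f) {θ : ℝ}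
    (hfinv : ∀ U : GaugeConfig 3 L SU2, f (ownShift θ U) = f U) {β : ℝ} (hβ : 0 ≤ β) (n : ℕ) {s t w c₀ σ : ℝ} (hσ : 0 < σ) (hσ1 : σ ≤ 1)
    (hσle : σ ≤ c₀ / 2 - 2 * (L * (L * Real.sqrt s)) - n * (L * t)) (hθ0 : θ ≤ 0) (hθσ : -θ ≤ σ / 2) (hθπ : -θ ≤ Real.pi / 2) :
    sectorWeight β n z (fun Us g =>
        {p : (Site 3 L → SU2) × (Fin (n + 1) → GaugeConfig 3 L SU2) |
          p ∈ goodEvent n z s t ∧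
          (|polDist (p.2 0) - f (p.2 0)| ≤ w ∧ c₀ < polDist (p.2 0)) ∧
          (su2Quat (polyX (p.2 0))).re ≤ 0}.indicator (fun _ => (1 : ℝ)) (g, Us)) ≤
      Real.exp (β * ((n + 1 : ℕ) * (Fintype.card (Plaquette 3 L) * ((|θ| * (2 * (L * Real.sqrt s) / σ)) ^ 2 + 2 * (|θ| * (2 * (L * Real.sqrt s) / σ)) * Real.sqrt s) +
          Fintype.card (Edge 3 L) * ((|θ| * (2 * (L * t) / σ)) ^ 2 + 2 * (|θ| * (2 * (L * t) / σ)) * t)))) *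
        ((((1 - |θ| / σ) ^ 2)⁻¹) ^ (Finset.univ.filter (fun x : Site 3 L => x 0 = 0)).card) ^ (n + 1) *
      sectorWeight β n z (fun Us g =>
        {p : (Site 3 L → SU2) × (Fin (n + 1) → GaugeConfig 3 L SU2) |
          (Real.pi / 2 ≤ Real.arccos (su2Quat (polyX (p.2 0))).re - θ ∧ Real.arccos (su2Quat (polyX (p.2 0))).re - θ ≤ Real.pi) ∧
          |Real.sqrt (4 - 4 * |Real.cos (Real.arccos (su2Quat (polyX (p.2 0))).re - θ)|) - f (p.2 0)| ≤ w ∧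
          c₀ < Real.sqrt (4 - 4 * |Real.cos (Real.arccos (su2Quat (polyX (p.2 0))).re - θ)|)}.indicator (fun _ => (1 : ℝ)) (g, Us)) := by
  have hθabs : |θ| = -θ := abs_of_nonpos hθ0
  have hθ' : |θ| ≤ σ / 2 := by rw [hθabs]; exact hθσ
  have ha : 0 < Real.arcsin σ := Real.arcsin_pos.2 hσ
  have hσa : σ ≤ Real.arcsin σ := le_arcsin_self hσ.le hσ1
  have hbπ : Real.pi - Real.arcsin σ < Real.pi := by linarith
  have haθ : 0 < Real.arcsin σ + θ := by linarith
  have hbθ : Real.pi - Real.arcsin σ + θ < Real.pi := by linarith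
  have hρ : 0 ≤ ((1 - |θ| / σ) ^ 2)⁻¹ := by positivity
  have hsin : ∀ r : ℝ, Real.arcsin σ ≤ r → r ≤ Real.pi - Real.arcsin σ → Real.sin r ^ 2 ≤ ((1 - |θ| / σ) ^ 2)⁻¹ * Real.sin (r + θ) ^ 2 :=
    fun r hr1 hr2 => sin_sq_le_rho_mul hσ hσ1 hθ' hr1 hr2
  have hproj : Measurable fun p : (Site 3 L → SU2) × (Fin (n + 1) → GaugeConfig 3 L SU2) => p.2 0 := (measurable_pi_apply 0).comp measurable_snd
  have hA : MeasurableSet {p : (Site 3 L → SU2) × (Fin (n + 1) → GaugeConfig 3 L SU2) |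
      p ∈ goodEvent n z s t ∧
      (|polDist (p.2 0) - f (p.2 0)| ≤ w ∧ c₀ < polDist (p.2 0)) ∧
      (su2Quat (polyX (p.2 0))).re ≤ 0} := by
    have h1 : MeasurableSet {p : (Site 3 L → SU2) × (Fin (n + 1) → GaugeConfig 3 L SU2) | p ∈ goodEvent n z s t} :=
      measurableSet_goodEvent (L := L) n z s t
    have h2 : MeasurableSet {p : (Site 3 L → SU2) × (Fin (n + 1) → GaugeConfig 3 L SU2) |
        |polDist (p.2 0) - f (p.2 0)| ≤ w ∧ c₀ < polDist (p.2 0)} := hproj (measurableSet_stripGen (L := L) hfm w c₀)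
    have h3 : MeasurableSet {p : (Site 3 L → SU2) × (Fin (n + 1) → GaugeConfig 3 L SU2) | (su2Quat (polyX (p.2 0))).re ≤ 0} :=
      measurableSet_le (measurable_re_su2Quat_polyX.comp hproj) measurable_const
    rw [measurableSet_setOf] at h1 h2 h3 ⊢
    exact h1.and (h2.and h3)
  have hr : Measurable fun p : (Site 3 L → SU2) × (Fin (n + 1) → GaugeConfig 3 L SU2) => Real.arccos (su2Quat (polyX (p.2 0))).re - θ :=
    (Real.continuous_arccos.measurable.comp (measurable_re_su2Quat_polyX.comp hproj)).sub measurable_const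
  have hg : Measurable fun p : (Site 3 L → SU2) × (Fin (n + 1) → GaugeConfig 3 L SU2) =>
      Real.sqrt (4 - 4 * |Real.cos (Real.arccos (su2Quat (polyX (p.2 0))).re - θ)|) :=
    (measurable_const.sub ((Real.continuous_cos.measurable.comp hr).abs.const_mul _)).sqrt
  have hpdS : Measurable fun p : (Site 3 L → SU2) × (Fin (n + 1) → GaugeConfig 3 L SU2) => f (p.2 0) := hfm.comp hproj
  have hB : MeasurableSet {p : (Site 3 L → SU2) × (Fin (n + 1) → GaugeConfig 3 L SU2) |
      (Real.pi / 2 ≤ Real.arccos (su2Quat (polyX (p.2 0))).re - θ ∧ Real.arccos (su2Quat (polyX (p.2 0))).re - θ ≤ Real.pi) ∧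
      |Real.sqrt (4 - 4 * |Real.cos (Real.arccos (su2Quat (polyX (p.2 0))).re - θ)|) - f (p.2 0)| ≤ w ∧
      c₀ < Real.sqrt (4 - 4 * |Real.cos (Real.arccos (su2Quat (polyX (p.2 0))).re - θ)|)} := by
    have h1 := measurableSet_le (measurable_const (a := Real.pi / 2)) hr
    have h2 := measurableSet_le hr (measurable_const (a := Real.pi))
    have h3 := measurableSet_le ((hg.sub hpdS).abs) (measurable_const (a := w))
    have h4 := measurableSet_lt (measurable_const (a := c₀)) hg
    rw [measurableSet_setOf] at h1 h2 h3 h4 ⊢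
    exact (h1.and h2).and (h3.and h4)
  refine sectorWeight_indicator_le_of_ownShift (L := L) β n z ha hbπ haθ hbθ hρ hsin hA hB ?_ ?_ (Real.exp_pos _).le ?_
  · rintro p ⟨hgood, ⟨-, hcore⟩, -⟩ k x hx
    exact lineHolonomy_mem_shell_of_goodEvent_z z hσ hgood (by linarith) k hx
  · rintro p ⟨hgood, ⟨hstrip, hcore⟩, hre⟩
    have hfloor : σ ≤ ‖imVec (su2Quat (polyX (p.2 0)))‖ := by
      rw [polyX_eq_lineHolonomy]
      exact floor_of_goodEvent_z z hgood (by linarith) 0 0 (by simp)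
    have hnc : imVec (su2Quat (polyX (p.2 0))) ≠ 0 := fun h => by rw [h, norm_zero] at hfloor; linarith
    set r := Real.arccos (su2Quat (polyX (p.2 0))).re with hrdef
    have hrπ : r ≤ Real.pi := Real.arccos_le_pi _
    have hrπ2 : Real.pi / 2 ≤ r := by
      rw [hrdef]
      rcases hre.lt_or_eq with hlt | heq
      · exact le_of_lt (not_le.1 ((Real.arccos_le_pi_div_two.not).2 (not_le.2 hlt)))
      · rw [heq, Real.arccos_zero]
    simp only [Set.mem_setOf_eq]
    rw [polyX_ownShift, arccos_re_classShift hnc (by linarith) (by linarith), hfinv,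
      show Real.arccos (su2Quat (polyX (p.2 0))).re + θ - θ = r by rw [hrdef]; ring, ← vacDist_eq_sqrt_angle]
    exact ⟨⟨hrπ2, hrπ⟩, hstrip, hcore⟩
  · rintro p ⟨hgood, ⟨-, hcore⟩, -⟩
    obtain ⟨hP, hTi, hTs⟩ := goodEvent_dictionary_z z hgood
    have hNC : ∀ (k : Fin (n + 1)) (y : Site 3 L), y 0 = 0 → σ ≤ ‖imVec (su2Quat (lineHolonomy (p.2 k) 0 L y))‖ :=
      fun k y hy => floor_of_goodEvent_z z hgood (by linarith) k y hy
    exact seamDensity_le_exp_mul_ownShift_z hz hβ θ hσ p.2 p.1 hNC hP hTi hTs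

/-! ## §4 The images of different shifts are disjoint -/

omit [NeZero L] in
/-- ★ **Lower images are pairwise disjoint** for shift multiples of `θ' ≥ 5w`, `w ≥ 0`. [folklore] -/
theorem B_disjoint_lowerGen (f : GaugeConfig 3 L SU2 → ℝ) (n : ℕ) {w c₀ θ' : ℝ} (hw : 0 ≤ w) (hθ' : 5 * w < θ') :
    Pairwise (Function.onFun Disjoint fun k : ℕ =>
      {p : (Site 3 L → SU2) × (Fin (n + 1) → GaugeConfig 3 L SU2) |
        (0 ≤ Real.arccos (su2Quat (polyX (p.2 0))).re - (k + 1 : ℕ) * θ' ∧ Real.arccos (su2Quat (polyX (p.2 0))).re - (k + 1 : ℕ) * θ' ≤ Real.pi / 2) ∧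
        |Real.sqrt (4 - 4 * |Real.cos (Real.arccos (su2Quat (polyX (p.2 0))).re - (k + 1 : ℕ) * θ')|) - f (p.2 0)| ≤ w ∧
        c₀ < Real.sqrt (4 - 4 * |Real.cos (Real.arccos (su2Quat (polyX (p.2 0))).re - (k + 1 : ℕ) * θ')|)}) := by
  intro j k hjk
  rw [Function.onFun, Set.disjoint_left]
  rintro p ⟨⟨hj0, hj1⟩, hjs, -⟩ ⟨⟨hk0, hk1⟩, hks, -⟩
  set r := Real.arccos (su2Quat (polyX (p.2 0))).re
  have hsep := abs_sub_le_of_strip (Or.inl ⟨hj0, hj1, hk0, hk1⟩) hjs hks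
  have hdiff : |(r - (j + 1 : ℕ) * θ') - (r - (k + 1 : ℕ) * θ')| = |((k : ℝ) - j)| * θ' := by
    have hθpos : 0 < θ' := by linarith
    rw [show (r - (j + 1 : ℕ) * θ') - (r - (k + 1 : ℕ) * θ') = ((k : ℝ) - j) * θ' by push_cast; ring, abs_mul, abs_of_pos hθpos]
  rw [hdiff] at hsep
  have hone : (1 : ℝ) ≤ |((k : ℝ) - j)| := by
    have : (1 : ℤ) ≤ |((k : ℤ) - j)| := Int.one_le_abs (by omega)
    have h2 : |((k : ℝ) - j)| = (|((k : ℤ) - j)| : ℤ) := by push_cast; rfl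
    rw [h2]; exact_mod_cast this
  nlinarith

omit [NeZero L] in
/-- ★ **Upper images are pairwise disjoint** for shift multiples of `θ' ≥ 5w` (shifts `−(k+1)θ'`). [folklore] -/
theorem B_disjoint_upperGen (f : GaugeConfig 3 L SU2 → ℝ) (n : ℕ) {w c₀ θ' : ℝ} (hw : 0 ≤ w) (hθ' : 5 * w < θ') :
    Pairwise (Function.onFun Disjoint fun k : ℕ =>
      {p : (Site 3 L → SU2) × (Fin (n + 1) → GaugeConfig 3 L SU2) |
        (Real.pi / 2 ≤ Real.arccos (su2Quat (polyX (p.2 0))).re - (-((k + 1 : ℕ) * θ')) ∧ Real.arccos (su2Quat (polyX (p.2 0))).re - (-((k + 1 : ℕ) * θ')) ≤ Real.pi) ∧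
        |Real.sqrt (4 - 4 * |Real.cos (Real.arccos (su2Quat (polyX (p.2 0))).re - (-((k + 1 : ℕ) * θ')))|) - f (p.2 0)| ≤ w ∧
        c₀ < Real.sqrt (4 - 4 * |Real.cos (Real.arccos (su2Quat (polyX (p.2 0))).re - (-((k + 1 : ℕ) * θ')))|)}) := by
  intro j k hjk
  rw [Function.onFun, Set.disjoint_left]
  rintro p ⟨⟨hj0, hj1⟩, hjs, -⟩ ⟨⟨hk0, hk1⟩, hks, -⟩
  set r := Real.arccos (su2Quat (polyX (p.2 0))).re
  have hsep := abs_sub_le_of_strip (Or.inr ⟨hj0, hj1, hk0, hk1⟩) hjs hks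
  have hdiff : |(r - -((j + 1 : ℕ) * θ')) - (r - -((k + 1 : ℕ) * θ'))| = |((j : ℝ) - k)| * θ' := by
    have hθpos : 0 < θ' := by linarith
    rw [show (r - -((j + 1 : ℕ) * θ')) - (r - -((k + 1 : ℕ) * θ')) = ((j : ℝ) - k) * θ' by push_cast; ring, abs_mul, abs_of_pos hθpos]
  rw [hdiff] at hsep
  have hone : (1 : ℝ) ≤ |((j : ℝ) - k)| := by
    have : (1 : ℤ) ≤ |((j : ℤ) - k)| := Int.one_le_abs (by omega)
    have h2 : |((j : ℝ) - k)| = (|((j : ℤ) - k)| : ℤ) := by push_cast; rfl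
    rw [h2]; exact_mod_cast this
  nlinarith

end Summit.QuantumFields.YangMills.Theorems.FemtoTransferGap.OwnAxis

end
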